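import Summits.QuantumFields.BalabanUV.Gaps.D1PinnedFirstOrderBilinear
import Summits.QuantumFields.BalabanUV.Gaps.D1PinnedColourScaling
import Summits.QuantumFields.BalabanUV.Beta.GAN24.Lin4Additive
import Summits.QuantumFields.BalabanUV.Beta.GAN24.WSlotT2OfPieces
import Summits.QuantumFields.BalabanUV.Beta.SecondOrderRemainderTables

/-!
# `BalabanUV.Gaps.D1PinnedColourRayQuartic` — cell pub-balaban-gaps, row (D1), seat g1-p1: ALONG EVERY COLOUR RAY `t ↦ t·c⃗ = (t·cE, t·cVH, t·cΛ)` an2's RECURSIVE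
# BI-STENCIL FAMILY IS A POLYNOMIAL OF DEGREE ≤ 4 IN `t` WITH NO LINEAR TERM — in the FIVE-NODE ∕ MOMENT FORM: for any nodes `s₀,…,s₄` and weights `w₀,…,w₄` with
# `Σ wᵢ = 1`, `Σ wᵢ sᵢ² = t²`, `Σ wᵢ sᵢ³ = t³`, `Σ wᵢ sᵢ⁴ = t⁴`:  `T2Of(t·c⃗) j = Σᵢ wᵢ • T2Of(sᵢ·c⃗) j` and `WbalOf(t·c⃗)(T2Of(t·c⃗)) j = Σᵢ wᵢ • WbalOf(sᵢ·c⃗)(T2Of(sᵢ·c⃗)) j`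
# (every level `j`, any `cE₂, cB, T`, any certified border ∕ mixed tables) — census row 72b, steps (1)–(3)

HONEST FRAMING (cell rule, page 1 of everything): [folklore] kernel algebra BY NAME over tree theorems — the sibling `Gaps/D1PinnedFirstOrderBilinear` (§5–§6: the first-order source along
a quadratic pair path is an explicit quartic), GEN 10's `Gaps/D1PinnedColourScaling` (`Spure (t·c⃗) = t²•A + t•B`, `M1 (t·cΛ) = t•M1 cΛ`), gan24's `T2RecursionAffine.vsym ∕ W2SymOfK_eq_add_vsym`
and `Lin4Additive.vsym_add ∕ vsym_smul`, an2's `BalabanStepW2` (`T2Of_succ ∕ T2Of_loc ∕ locStencil_Spure ∕ vertexFamily_M1 ∕ locStencilFM_M2Of ∕ e4OfW ∕ K3OfK`), the β sub-cell's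
`SecondOrderResponse.vertexFamily₂_W2SymOfK'`, `TameKernelCalculus` (`Spr ∕ Loc`), an4's `decays_KInvStep`, `VertexReflectionContact.mmRead_add`, `ThirdJetKernel.mmRead_smul`.  NOTHING of
Bałaban's asserted beyond print; [Balaban1987RG1] Thm 2 UNPROVED IN PRINT; which member is print's ((P6)) NOT decided; NO coefficient computed or signed; (D1) NOT discharged; 0∕4 row-D1
binders; NOT `BetaPertH`, NOT continuum, NOT Clay.  HONEST DEPENDENCY (b2b cell, verbatim): «continuum YM on T⁴ ⇐ BetaPertH ∧ nine spine estimates (0/9 proved); BetaPertH ⇐ (D1) ∧ (D4) ∧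
CAP+tail; G-an2-4 gates asym, D1 and NE2/3/4.»

WHY.  In an2's recursion `T2Of_succ` the colour triple enters member `j+1` through the first-order pair `(Spure (t·c⃗) j, M1 (t·cΛ) j) = (t²A_j + tB_j, t•M_j)` — a QUADRATIC PAIR PATH —
and through member `j` in the bi-stencil slot, which is affine (`W2SymOfK_eq_add_vsym`) and universal.  By the sibling file the first-order source is `G(0) + t²G₂ + t³G₃ + t⁴G₄`; the
bi-stencil slot maps a five-node combination to the same combination (`vsym_wsum5`, `sandwich_wsum5`); the border is constant and `Σ wᵢ = 1`.  Induction on `j`.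
CONTENT (all [folklore]; no `def`, no `def … : Prop`, 0 sorry): §1 `sandwich_wsum5`, `sandwich_wsum3`, `vsym_wsum5`, `loc_vsym`, `loc_W2Sym_zero`; §2 **`K3OfK_source_decomp`** (one level, generic
certified data: `K3OfK K N x(s) (W2SymOfK K N x(s) T M₂) = −[s⁴X₄ + s³X₃ + s²X₂] − K∘W♭∘K − K∘vsym(T)∘K − ½[s⁴ K∘E₄∘K + s³ K∘E₃∘K + s² K∘E₂∘K]`), **`K3OfK_ray_nodes`** (the five-node identity at
one level); §3 `Spure_ray`, `M1_ray`, **`T2Of_ray_nodes`** (the tower); §4 **`WbalOf_ray_nodes`**.  The pinned consequences (`β⁰_j`, `lim β⁰`, `φ`) are the sibling `Gaps/D1PinnedColourRayReadings`.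

Provenance: cell pub-balaban-gaps, seat g1-p1 GEN 11 (prover-pub-balaban-gaps-g1-p1-g11-0), 2026-08-24; imports the two unbuilt siblings (DEFERRED at the gate until their oleans build;
CONCAT certificate in the seat records); no existing file touched.
-/

noncomputable section

open Finset
open scoped BigOperators
open Literature.MathematicalPhysics.QuantumFieldTheory Balaban1983to89 Balaban1983to89.Beta
open ExpKernelCalculus (MKer Decays BiLoc VertexFamily VertexFamily₂ comp)
open OneStepResolventKernel (Fib LocStencil biLoc_mono decays_mono)
open OneStepKernelFamily (KInvStep decays_KInvStep)
open SecondOrderResponse (dM K2OfK W2SymOfK W2OfK LocStencilFM vertexFamily₂_W2SymOfK')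
open BalabanCompositeJets (LocStencil₂)
open BalabanStepJetsSucc (mmRead e3Of)
open BalabanStepW2 (Spure M1 M2Of WbalOf T2Of T2Of_zero T2Of_succ T2Of_loc e4OfW K3OfK wV4 wB2 locStencil_Spure vertexFamily_M1 locStencilFM_M2Of)
open StepJetData (locStencil_smul)
open Summit.QuantumFields.BalabanUV.Beta.TameKernelCalculus (Spr Loc)
open Summit.QuantumFields.BalabanUV.Beta.GAN24.T2RecursionAffine (vsym W2SymOfK_eq_add_vsym)
open Summit.QuantumFields.BalabanUV.Beta.GAN24.Lin4Additive (vsym_add vsym_smul)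
open Summit.QuantumFields.BalabanUV.Beta.GAN24.WSlotT2OfPieces (locStencil₂_zero)
open Summit.QuantumFields.BalabanUV.Beta.GAN24.ThirdJetKernel (mmRead_smul)
open Summit.QuantumFields.BalabanUV.Beta.VertexReflectionContact (mmRead_add)
open Summit.QuantumFields.BalabanUV.Beta.SecondOrderRemainderTables (abs_le_of_locStencil₂)
open Summit.QuantumFields.BalabanUV.Beta.BubbleParity (spr_of_decays)
open Summit.QuantumFields.BalabanUV.Gaps.D1PinnedFirstOrderBilinear (sandwich_add loc_dM_of_certs decays_K2OfK_of_certs certs_zero K3OfK_pure_path W2SymOfK_path)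
open Summit.QuantumFields.BalabanUV.Gaps.D1PinnedColourScaling (Spure_colourScale_zero Spure_colourScale_succ M1_colourScale)

namespace Summit.QuantumFields.BalabanUV.Gaps.D1PinnedColourRayQuartic

variable {d : ℕ} {N : ℕ} [NeZero N]

/-! ## §1 Weighted five-sums pass through the sandwich and the symmetrised bi-vertex; `Loc` certificates -/

omit [NeZero N] in
/-- [folklore] The sandwich of a weighted five-sum of localised kernels (`sandwich_add` ×4, `comp_smul_left ∕ _right`). -/
theorem sandwich_wsum5 {K X₀ X₁ X₂ X₃ X₄ : MKer (d + 1) (Fib d)} (hKs : Spr K) (h₀ : Loc X₀) (h₁ : Loc X₁) (h₂ : Loc X₂) (h₃ : Loc X₃) (h₄ : Loc X₄) (w₀ w₁ w₂ w₃ w₄ : ℝ) :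
    comp (comp K (w₀ • X₀ + w₁ • X₁ + w₂ • X₂ + w₃ • X₃ + w₄ • X₄)) K =
      w₀ • comp (comp K X₀) K + w₁ • comp (comp K X₁) K + w₂ • comp (comp K X₂) K + w₃ • comp (comp K X₃) K + w₄ • comp (comp K X₄) K := by
  rw [sandwich_add hKs ((((h₀.smul w₀).add (h₁.smul w₁)).add (h₂.smul w₂)).add (h₃.smul w₃)) (h₄.smul w₄),
    sandwich_add hKs (((h₀.smul w₀).add (h₁.smul w₁)).add (h₂.smul w₂)) (h₃.smul w₃), sandwich_add hKs ((h₀.smul w₀).add (h₁.smul w₁)) (h₂.smul w₂),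
    sandwich_add hKs (h₀.smul w₀) (h₁.smul w₁)]
  simp only [KernelReflection.comp_smul_right, KernelReflection.comp_smul_left]

omit [NeZero N] in
/-- [folklore] The sandwich of a weighted three-sum of localised kernels. -/
theorem sandwich_wsum3 {K X₂ X₃ X₄ : MKer (d + 1) (Fib d)} (hKs : Spr K) (h₂ : Loc X₂) (h₃ : Loc X₃) (h₄ : Loc X₄) (a₄ a₃ a₂ : ℝ) :
    comp (comp K (a₄ • X₄ + a₃ • X₃ + a₂ • X₂)) K = a₄ • comp (comp K X₄) K + a₃ • comp (comp K X₃) K + a₂ • comp (comp K X₂) K := by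
  rw [sandwich_add hKs ((h₄.smul a₄).add (h₃.smul a₃)) (h₂.smul a₂), sandwich_add hKs (h₄.smul a₄) (h₃.smul a₃)]
  simp only [KernelReflection.comp_smul_right, KernelReflection.comp_smul_left]

/-- [folklore] A weighted combination of five bounded reals with coefficients dominated by `|wᵢ|` is bounded by `(Σ|wᵢ|)·Bd`. -/
private theorem abs_comb_le {t₀ t₁ t₂ t₃ t₄ Bd : ℝ} (h₀ : |t₀| ≤ Bd) (h₁ : |t₁| ≤ Bd) (h₂ : |t₂| ≤ Bd) (h₃ : |t₃| ≤ Bd) (h₄ : |t₄| ≤ Bd)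
    {w₀ w₁ w₂ w₃ w₄ c₀ c₁ c₂ c₃ c₄ : ℝ} (hc₀ : |c₀| ≤ |w₀|) (hc₁ : |c₁| ≤ |w₁|) (hc₂ : |c₂| ≤ |w₂|) (hc₃ : |c₃| ≤ |w₃|) (hc₄ : |c₄| ≤ |w₄|) :
    |c₀ * t₀ + c₁ * t₁ + c₂ * t₂ + c₃ * t₃ + c₄ * t₄| ≤ (|w₀| + |w₁| + |w₂| + |w₃| + |w₄|) * Bd := by
  have e : ∀ {c w t : ℝ}, |c| ≤ |w| → |t| ≤ Bd → |c * t| ≤ |w| * Bd := fun hc ht => by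
    rw [abs_mul]; exact mul_le_mul hc ht (abs_nonneg _) (abs_nonneg _)
  have a₁ := abs_add_le (c₀ * t₀ + c₁ * t₁ + c₂ * t₂ + c₃ * t₃) (c₄ * t₄)
  have a₂ := abs_add_le (c₀ * t₀ + c₁ * t₁ + c₂ * t₂) (c₃ * t₃)
  have a₃ := abs_add_le (c₀ * t₀ + c₁ * t₁) (c₂ * t₂)
  have a₄ := abs_add_le (c₀ * t₀) (c₁ * t₁)
  linarith [e hc₀ h₀, e hc₁ h₁, e hc₂ h₂, e hc₃ h₃, e hc₄ h₄]

omit [NeZero N] in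
/-- [folklore] **THE SYMMETRISED BI-VERTEX OF A WEIGHTED FIVE-SUM OF BOUNDED TABLES** (decaying `K`; `vsym_add` ×4 on the partial sums, `vsym_smul` ×5). -/
theorem vsym_wsum5 {K : MKer (d + 1) (Fib d)} {C δ : ℝ} (hK : Decays K C δ) (hδ : 0 < δ) (N : ℕ)
    {T₀ T₁ T₂ T₃ T₄ : Fin (d + 1) → (Fin (d + 1) → ℤ) → Fin (d + 1) → (Fin (d + 1) → ℤ) → MKer (d + 1) (Fib d)} {Bd : ℝ}
    (h₀ : ∀ κ u κ' u' x z a b, |T₀ κ u κ' u' x z a b| ≤ Bd) (h₁ : ∀ κ u κ' u' x z a b, |T₁ κ u κ' u' x z a b| ≤ Bd) (h₂ : ∀ κ u κ' u' x z a b, |T₂ κ u κ' u' x z a b| ≤ Bd)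
    (h₃ : ∀ κ u κ' u' x z a b, |T₃ κ u κ' u' x z a b| ≤ Bd) (h₄ : ∀ κ u κ' u' x z a b, |T₄ κ u κ' u' x z a b| ≤ Bd) (w₀ w₁ w₂ w₃ w₄ : ℝ)
    (μ : Fin (d + 1)) (y : Fin (d + 1) → ℤ) (ν : Fin (d + 1)) (y' : Fin (d + 1) → ℤ) :
    vsym K N (w₀ • T₀ + w₁ • T₁ + w₂ • T₂ + w₃ • T₃ + w₄ • T₄) μ y ν y' =
      w₀ • vsym K N T₀ μ y ν y' + w₁ • vsym K N T₁ μ y ν y' + w₂ • vsym K N T₂ μ y ν y' + w₃ • vsym K N T₃ μ y ν y' + w₄ • vsym K N T₄ μ y ν y' := by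
  -- every weighted member and every partial sum is bounded by `Bw`
  have key : ∀ c₀ c₁ c₂ c₃ c₄ : ℝ, |c₀| ≤ |w₀| → |c₁| ≤ |w₁| → |c₂| ≤ |w₂| → |c₃| ≤ |w₃| → |c₄| ≤ |w₄| →
      ∀ κ u κ' u' x z a b, |(c₀ • T₀ + c₁ • T₁ + c₂ • T₂ + c₃ • T₃ + c₄ • T₄) κ u κ' u' x z a b| ≤ (|w₀| + |w₁| + |w₂| + |w₃| + |w₄|) * Bd := by
    intro c₀ c₁ c₂ c₃ c₄ hc₀ hc₁ hc₂ hc₃ hc₄ κ u κ' u' x z a b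
    simp only [Pi.add_apply, Pi.smul_apply, smul_eq_mul]
    exact abs_comb_le (h₀ κ u κ' u' x z a b) (h₁ κ u κ' u' x z a b) (h₂ κ u κ' u' x z a b) (h₃ κ u κ' u' x z a b) (h₄ κ u κ' u' x z a b) hc₀ hc₁ hc₂ hc₃ hc₄
  have z₀ : |(0 : ℝ)| ≤ |w₀| := by rw [abs_zero]; exact abs_nonneg _
  have z₁ : |(0 : ℝ)| ≤ |w₁| := by rw [abs_zero]; exact abs_nonneg _
  have z₂ : |(0 : ℝ)| ≤ |w₂| := by rw [abs_zero]; exact abs_nonneg _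
  have z₃ : |(0 : ℝ)| ≤ |w₃| := by rw [abs_zero]; exact abs_nonneg _
  have z₄ : |(0 : ℝ)| ≤ |w₄| := by rw [abs_zero]; exact abs_nonneg _
  have p₄ := key w₀ w₁ w₂ w₃ 0 le_rfl le_rfl le_rfl le_rfl z₄
  have p₃ := key w₀ w₁ w₂ 0 0 le_rfl le_rfl le_rfl z₃ z₄
  have p₂ := key w₀ w₁ 0 0 0 le_rfl le_rfl z₂ z₃ z₄
  have b₀ := key w₀ 0 0 0 0 le_rfl z₁ z₂ z₃ z₄
  have b₁ := key 0 w₁ 0 0 0 z₀ le_rfl z₂ z₃ z₄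
  have b₂ := key 0 0 w₂ 0 0 z₀ z₁ le_rfl z₃ z₄
  have b₃ := key 0 0 0 w₃ 0 z₀ z₁ z₂ le_rfl z₄
  have b₄ := key 0 0 0 0 w₄ z₀ z₁ z₂ z₃ le_rfl
  simp only [zero_smul, add_zero, zero_add] at p₄ p₃ p₂ b₀ b₁ b₂ b₃ b₄
  rw [vsym_add hK hδ N p₄ b₄, vsym_add hK hδ N p₃ b₃, vsym_add hK hδ N p₂ b₂, vsym_add hK hδ N b₀ b₁, vsym_smul, vsym_smul, vsym_smul, vsym_smul, vsym_smul]

omit [NeZero N] in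
/-- [folklore] The zero mixed table is certified. -/
theorem locStencilFM_zero' : LocStencilFM N (0 : Fin (d + 1) → (Fin (d + 1) → ℤ) → Fin (d + 1) → (Fin (d + 1) → ℤ) → MKer (d + 1) (Fib d)) 0 1 :=
  fun κ u ρ w x z a b => by simp

/-- [folklore] **`Loc` OF THE `(S, M, S₂)`-FREE CARRIER** `W2SymOfK K N 0 0 0 M₂ b b′` (certified `M₂`; `vertexFamily₂_W2SymOfK'` with zero tables). -/
theorem loc_W2Sym_zero {K : MKer (d + 1) (Fib d)} (hK : ∃ δ C : ℝ, 0 < δ ∧ 0 ≤ C ∧ Decays K C δ)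
    {M₂ : Fin (d + 1) → (Fin (d + 1) → ℤ) → Fin (d + 1) → (Fin (d + 1) → ℤ) → MKer (d + 1) (Fib d)} (hM₂ : ∃ C δ : ℝ, 0 < δ ∧ LocStencilFM N M₂ C δ)
    (T : Fin (d + 1) → (Fin (d + 1) → ℤ) → Fin (d + 1) → (Fin (d + 1) → ℤ) → MKer (d + 1) (Fib d)) (hT : ∃ C δ : ℝ, 0 < δ ∧ LocStencil₂ T C δ)
    (μ : Fin (d + 1)) (y : Fin (d + 1) → ℤ) (ν : Fin (d + 1)) (y' : Fin (d + 1) → ℤ) :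
    Loc (W2SymOfK K N (fun (_ : Fin (d + 1)) (_ : Fin (d + 1) → ℤ) => (0 : MKer (d + 1) (Fib d))) (fun _ _ => 0) T M₂ μ y ν y') := by
  obtain ⟨CM, δM, hδM, hMl⟩ := hM₂
  obtain ⟨C₂, δ₂, hδ₂, hTl⟩ := hT
  obtain ⟨⟨C0, δ0, hδ0, hS0⟩, ⟨C1, δ1, hδ1, hM0⟩⟩ := certs_zero (d := d) (N := N)
  obtain ⟨Cw, δw, hδw, hW⟩ := vertexFamily₂_W2SymOfK' hK hS0 hδ0 hM0 hδ1 hTl hδ₂ hMl hδM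
  exact ⟨_, _, _, _, hδw, hW μ y ν y'⟩

/-- [folklore] **`Loc` OF THE SYMMETRISED BI-VERTEX** `vsym K N T b b′` of a certified bi-stencil table (as the difference of two certified carriers, `W2SymOfK_eq_add_vsym`). -/
theorem loc_vsym {K : MKer (d + 1) (Fib d)} (hK : ∃ δ C : ℝ, 0 < δ ∧ 0 ≤ C ∧ Decays K C δ)
    (T : Fin (d + 1) → (Fin (d + 1) → ℤ) → Fin (d + 1) → (Fin (d + 1) → ℤ) → MKer (d + 1) (Fib d)) (hT : ∃ C δ : ℝ, 0 < δ ∧ LocStencil₂ T C δ)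
    (μ : Fin (d + 1)) (y : Fin (d + 1) → ℤ) (ν : Fin (d + 1)) (y' : Fin (d + 1) → ℤ) : Loc (vsym K N T μ y ν y') := by
  have hz : ∃ C δ : ℝ, 0 < δ ∧ LocStencilFM N (0 : Fin (d + 1) → (Fin (d + 1) → ℤ) → Fin (d + 1) → (Fin (d + 1) → ℤ) → MKer (d + 1) (Fib d)) C δ := ⟨0, 1, one_pos, locStencilFM_zero'⟩
  have e := congrArg (fun F => F μ y ν y') (W2SymOfK_eq_add_vsym K N (fun (_ : Fin (d + 1)) (_ : Fin (d + 1) → ℤ) => (0 : MKer (d + 1) (Fib d))) (fun _ _ => 0) T 0)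
  simp only [Pi.add_apply] at e
  rw [show vsym K N T μ y ν y' = W2SymOfK K N (fun (_ : Fin (d + 1)) (_ : Fin (d + 1) → ℤ) => (0 : MKer (d + 1) (Fib d))) (fun _ _ => 0) T 0 μ y ν y' -
      W2SymOfK K N (fun (_ : Fin (d + 1)) (_ : Fin (d + 1) → ℤ) => (0 : MKer (d + 1) (Fib d))) (fun _ _ => 0) 0 0 μ y ν y' by rw [e]; abel]
  exact (loc_W2Sym_zero hK hz T hT μ y ν y').sub (loc_W2Sym_zero hK hz 0 ⟨0, 1, one_pos, locStencil₂_zero 1⟩ μ y ν y')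

/-! ## §2 One level, generic certified data: the source decomposition and the five-node identity -/

section OneLevel

variable {K : MKer (d + 1) (Fib d)} {A B P Q : Fin (d + 1) → (Fin (d + 1) → ℤ) → MKer (d + 1) (Fib d)}
  {M₂ : Fin (d + 1) → (Fin (d + 1) → ℤ) → Fin (d + 1) → (Fin (d + 1) → ℤ) → MKer (d + 1) (Fib d)}

/-- [folklore] **THE SOURCE OF an2's RECURSION ALONG A QUADRATIC PAIR PATH, DECOMPOSED**: for a decaying `K`, certified `A, B, P, Q, M₂` and a certified bi-stencil table `T`, at `x(s) = (s²A + sB, s²P + sQ)`,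
`K3OfK K N x(s) (W2SymOfK K N x(s) T M₂) b b′ = −[s⁴X₄ + s³X₃ + s²X₂] − K∘(W2SymOfK K N 0 0 0 M₂ b b′)∘K − K∘(vsym K N T b b′)∘K − ½•[s⁴•K∘E₄∘K + s³•K∘E₃∘K + s²•K∘E₂∘K]` — the `W`-free part
(`K3OfK_pure_path`), the data-free carrier, the bi-stencil slot (`W2SymOfK_eq_add_vsym`) and the carrier's first-order part (`W2SymOfK_path`), the sandwich split on `Loc` pieces. -/
theorem K3OfK_source_decomp (hK : ∃ δ C : ℝ, 0 < δ ∧ 0 ≤ C ∧ Decays K C δ) (hA : ∃ C δ : ℝ, 0 < δ ∧ LocStencil A C δ) (hB : ∃ C δ : ℝ, 0 < δ ∧ LocStencil B C δ)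
    (hP : ∃ C δ : ℝ, 0 < δ ∧ VertexFamily P N C δ) (hQ : ∃ C δ : ℝ, 0 < δ ∧ VertexFamily Q N C δ) (hM₂ : ∃ C δ : ℝ, 0 < δ ∧ LocStencilFM N M₂ C δ)
    (T : Fin (d + 1) → (Fin (d + 1) → ℤ) → Fin (d + 1) → (Fin (d + 1) → ℤ) → MKer (d + 1) (Fib d)) (hT : ∃ C δ : ℝ, 0 < δ ∧ LocStencil₂ T C δ)
    (s : ℝ) (μ : Fin (d + 1)) (y : Fin (d + 1) → ℤ) (ν : Fin (d + 1)) (y' : Fin (d + 1) → ℤ) :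
    K3OfK K N (fun κ u => s ^ 2 • A κ u + s • B κ u) (fun ρ w => s ^ 2 • P ρ w + s • Q ρ w)
        (W2SymOfK K N (fun κ u => s ^ 2 • A κ u + s • B κ u) (fun ρ w => s ^ 2 • P ρ w + s • Q ρ w) T M₂) μ y ν y' =
      -(s ^ 4 • (comp (comp K (dM K N A P μ y)) (K2OfK K N A P ν y') + comp (comp K (dM K N A P ν y')) (K2OfK K N A P μ y)) +
          s ^ 3 • (comp (comp K (dM K N A P μ y)) (K2OfK K N B Q ν y') + comp (comp K (dM K N B Q μ y)) (K2OfK K N A P ν y') +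
            (comp (comp K (dM K N A P ν y')) (K2OfK K N B Q μ y) + comp (comp K (dM K N B Q ν y')) (K2OfK K N A P μ y))) +
        s ^ 2 • (comp (comp K (dM K N B Q μ y)) (K2OfK K N B Q ν y') + comp (comp K (dM K N B Q ν y')) (K2OfK K N B Q μ y)))
      - comp (comp K (W2SymOfK K N (fun (_ : Fin (d + 1)) (_ : Fin (d + 1) → ℤ) => (0 : MKer (d + 1) (Fib d))) (fun _ _ => 0) 0 M₂ μ y ν y')) K
      - comp (comp K (vsym K N T μ y ν y')) K
      - (1 / 2 : ℝ) • (s ^ 4 • comp (comp K (dM (K2OfK K N A P ν y') N A P μ y + dM (K2OfK K N A P μ y) N A P ν y')) K +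
          s ^ 3 • comp (comp K (dM (K2OfK K N A P ν y') N B Q μ y + dM (K2OfK K N B Q ν y') N A P μ y + (dM (K2OfK K N A P μ y) N B Q ν y' + dM (K2OfK K N B Q μ y) N A P ν y'))) K +
          s ^ 2 • comp (comp K (dM (K2OfK K N B Q ν y') N B Q μ y + dM (K2OfK K N B Q μ y) N B Q ν y')) K) := by
  have hKs : Spr K := spr_of_decays hK
  have hp := K3OfK_pure_path hK hA hB hP hQ (W2SymOfK K N (fun κ u => s ^ 2 • A κ u + s • B κ u) (fun ρ w => s ^ 2 • P ρ w + s • Q ρ w) T M₂) s μ y ν y'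
  have e := congrArg (fun F => F μ y ν y') (W2SymOfK_eq_add_vsym K N (fun (_ : Fin (d + 1)) (_ : Fin (d + 1) → ℤ) => (0 : MKer (d + 1) (Fib d))) (fun _ _ => 0) T M₂)
  simp only [Pi.add_apply] at e
  have l0 : Loc (W2SymOfK K N (fun (_ : Fin (d + 1)) (_ : Fin (d + 1) → ℤ) => (0 : MKer (d + 1) (Fib d))) (fun _ _ => 0) 0 M₂ μ y ν y') :=
    loc_W2Sym_zero hK hM₂ 0 ⟨0, 1, one_pos, locStencil₂_zero 1⟩ μ y ν y'
  have lv : Loc (vsym K N T μ y ν y') := loc_vsym hK T hT μ y ν y'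
  have lAA : ∀ c z c' z', Loc (dM (K2OfK K N A P c' z') N A P c z) := fun c z c' z' => loc_dM_of_certs (decays_K2OfK_of_certs hK hA hP c' z') hA hP c z
  have lAB : ∀ c z c' z', Loc (dM (K2OfK K N A P c' z') N B Q c z) := fun c z c' z' => loc_dM_of_certs (decays_K2OfK_of_certs hK hA hP c' z') hB hQ c z
  have lBA : ∀ c z c' z', Loc (dM (K2OfK K N B Q c' z') N A P c z) := fun c z c' z' => loc_dM_of_certs (decays_K2OfK_of_certs hK hB hQ c' z') hA hP c z
  have lBB : ∀ c z c' z', Loc (dM (K2OfK K N B Q c' z') N B Q c z) := fun c z c' z' => loc_dM_of_certs (decays_K2OfK_of_certs hK hB hQ c' z') hB hQ c z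
  have l4 := (lAA μ y ν y').add (lAA ν y' μ y)
  have l3 := ((lAB μ y ν y').add (lBA μ y ν y')).add ((lAB ν y' μ y).add (lBA ν y' μ y))
  have l2 := (lBB μ y ν y').add (lBB ν y' μ y)
  have lE := (((l4.smul (s ^ 4)).add (l3.smul (s ^ 3))).add (l2.smul (s ^ 2))).smul (1 / 2 : ℝ)
  rw [eq_sub_of_add_eq hp, W2SymOfK_path hK hA hB hP hQ T M₂ s μ y ν y', e, sandwich_add hKs (l0.add lv) lE, sandwich_add hKs l0 lv, KernelReflection.comp_smul_right,
    KernelReflection.comp_smul_left, sandwich_wsum3 hKs l2 l3 l4]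
  abel

/-- [folklore] Five certified bi-stencil tables have a common uniform bound. -/
theorem common_bound₂ {T₀ T₁ T₂ T₃ T₄ : Fin (d + 1) → (Fin (d + 1) → ℤ) → Fin (d + 1) → (Fin (d + 1) → ℤ) → MKer (d + 1) (Fib d)}
    (hT₀ : ∃ C δ : ℝ, 0 < δ ∧ LocStencil₂ T₀ C δ) (hT₁ : ∃ C δ : ℝ, 0 < δ ∧ LocStencil₂ T₁ C δ) (hT₂ : ∃ C δ : ℝ, 0 < δ ∧ LocStencil₂ T₂ C δ) (hT₃ : ∃ C δ : ℝ, 0 < δ ∧ LocStencil₂ T₃ C δ)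
    (hT₄ : ∃ C δ : ℝ, 0 < δ ∧ LocStencil₂ T₄ C δ) :
    ∃ Bd : ℝ, (∀ κ u κ' u' x z a b, |T₀ κ u κ' u' x z a b| ≤ Bd) ∧ (∀ κ u κ' u' x z a b, |T₁ κ u κ' u' x z a b| ≤ Bd) ∧ (∀ κ u κ' u' x z a b, |T₂ κ u κ' u' x z a b| ≤ Bd) ∧
      (∀ κ u κ' u' x z a b, |T₃ κ u κ' u' x z a b| ≤ Bd) ∧ (∀ κ u κ' u' x z a b, |T₄ κ u κ' u' x z a b| ≤ Bd) := by
  obtain ⟨C₀, δ₀, hδ₀, h₀⟩ := hT₀; obtain ⟨C₁, δ₁, hδ₁, h₁⟩ := hT₁; obtain ⟨C₂, δ₂, hδ₂, h₂⟩ := hT₂; obtain ⟨C₃, δ₃, hδ₃, h₃⟩ := hT₃; obtain ⟨C₄, δ₄, hδ₄, h₄⟩ := hT₄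
  have n₀ : 0 ≤ C₀ := (abs_nonneg _).trans (abs_le_of_locStencil₂ h₀ hδ₀.le 0 0 0 0 0 0 (Sum.inl 0) (Sum.inl 0))
  have n₁ : 0 ≤ C₁ := (abs_nonneg _).trans (abs_le_of_locStencil₂ h₁ hδ₁.le 0 0 0 0 0 0 (Sum.inl 0) (Sum.inl 0))
  have n₂ : 0 ≤ C₂ := (abs_nonneg _).trans (abs_le_of_locStencil₂ h₂ hδ₂.le 0 0 0 0 0 0 (Sum.inl 0) (Sum.inl 0))
  have n₃ : 0 ≤ C₃ := (abs_nonneg _).trans (abs_le_of_locStencil₂ h₃ hδ₃.le 0 0 0 0 0 0 (Sum.inl 0) (Sum.inl 0))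
  have n₄ : 0 ≤ C₄ := (abs_nonneg _).trans (abs_le_of_locStencil₂ h₄ hδ₄.le 0 0 0 0 0 0 (Sum.inl 0) (Sum.inl 0))
  exact ⟨C₀ + C₁ + C₂ + C₃ + C₄, fun κ u κ' u' x z a b => (abs_le_of_locStencil₂ h₀ hδ₀.le κ u κ' u' x z a b).trans (by linarith),
    fun κ u κ' u' x z a b => (abs_le_of_locStencil₂ h₁ hδ₁.le κ u κ' u' x z a b).trans (by linarith), fun κ u κ' u' x z a b => (abs_le_of_locStencil₂ h₂ hδ₂.le κ u κ' u' x z a b).trans (by linarith),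
    fun κ u κ' u' x z a b => (abs_le_of_locStencil₂ h₃ hδ₃.le κ u κ' u' x z a b).trans (by linarith), fun κ u κ' u' x z a b => (abs_le_of_locStencil₂ h₄ hδ₄.le κ u κ' u' x z a b).trans (by linarith)⟩

/-- [folklore] **THE FIVE-NODE IDENTITY AT ONE LEVEL** (generic certified data): if the bi-stencil slot carries a five-node combination `Tt = Σ wᵢ • Tᵢ` with weights of moments `Σ wᵢ = 1`, `Σ wᵢ sᵢ^k = t^k`
(`k = 2, 3, 4`), then so does the source: `K3OfK K N x(t) (W2SymOfK K N x(t) Tt M₂) b b′ = Σ wᵢ • K3OfK K N x(sᵢ) (W2SymOfK K N x(sᵢ) Tᵢ M₂) b b′` — NO first moment is needed (no linear term). -/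
theorem K3OfK_ray_nodes (hK : ∃ δ C : ℝ, 0 < δ ∧ 0 ≤ C ∧ Decays K C δ) (hA : ∃ C δ : ℝ, 0 < δ ∧ LocStencil A C δ) (hB : ∃ C δ : ℝ, 0 < δ ∧ LocStencil B C δ)
    (hP : ∃ C δ : ℝ, 0 < δ ∧ VertexFamily P N C δ) (hQ : ∃ C δ : ℝ, 0 < δ ∧ VertexFamily Q N C δ) (hM₂ : ∃ C δ : ℝ, 0 < δ ∧ LocStencilFM N M₂ C δ)
    {T₀ T₁ T₂ T₃ T₄ Tt : Fin (d + 1) → (Fin (d + 1) → ℤ) → Fin (d + 1) → (Fin (d + 1) → ℤ) → MKer (d + 1) (Fib d)}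
    (hT₀ : ∃ C δ : ℝ, 0 < δ ∧ LocStencil₂ T₀ C δ) (hT₁ : ∃ C δ : ℝ, 0 < δ ∧ LocStencil₂ T₁ C δ) (hT₂ : ∃ C δ : ℝ, 0 < δ ∧ LocStencil₂ T₂ C δ) (hT₃ : ∃ C δ : ℝ, 0 < δ ∧ LocStencil₂ T₃ C δ)
    (hT₄ : ∃ C δ : ℝ, 0 < δ ∧ LocStencil₂ T₄ C δ) (hTt : ∃ C δ : ℝ, 0 < δ ∧ LocStencil₂ Tt C δ) (t s₀ s₁ s₂ s₃ s₄ w₀ w₁ w₂ w₃ w₄ : ℝ) (hm0 : w₀ + w₁ + w₂ + w₃ + w₄ = 1)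
    (hm2 : w₀ * s₀ ^ 2 + w₁ * s₁ ^ 2 + w₂ * s₂ ^ 2 + w₃ * s₃ ^ 2 + w₄ * s₄ ^ 2 = t ^ 2) (hm3 : w₀ * s₀ ^ 3 + w₁ * s₁ ^ 3 + w₂ * s₂ ^ 3 + w₃ * s₃ ^ 3 + w₄ * s₄ ^ 3 = t ^ 3)
    (hm4 : w₀ * s₀ ^ 4 + w₁ * s₁ ^ 4 + w₂ * s₂ ^ 4 + w₃ * s₃ ^ 4 + w₄ * s₄ ^ 4 = t ^ 4) (hsum : Tt = w₀ • T₀ + w₁ • T₁ + w₂ • T₂ + w₃ • T₃ + w₄ • T₄)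
    (μ : Fin (d + 1)) (y : Fin (d + 1) → ℤ) (ν : Fin (d + 1)) (y' : Fin (d + 1) → ℤ) :
    K3OfK K N (fun κ u => t ^ 2 • A κ u + t • B κ u) (fun ρ w => t ^ 2 • P ρ w + t • Q ρ w)
        (W2SymOfK K N (fun κ u => t ^ 2 • A κ u + t • B κ u) (fun ρ w => t ^ 2 • P ρ w + t • Q ρ w) Tt M₂) μ y ν y' =
      w₀ • K3OfK K N (fun κ u => s₀ ^ 2 • A κ u + s₀ • B κ u) (fun ρ w => s₀ ^ 2 • P ρ w + s₀ • Q ρ w)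
          (W2SymOfK K N (fun κ u => s₀ ^ 2 • A κ u + s₀ • B κ u) (fun ρ w => s₀ ^ 2 • P ρ w + s₀ • Q ρ w) T₀ M₂) μ y ν y' +
      w₁ • K3OfK K N (fun κ u => s₁ ^ 2 • A κ u + s₁ • B κ u) (fun ρ w => s₁ ^ 2 • P ρ w + s₁ • Q ρ w)
          (W2SymOfK K N (fun κ u => s₁ ^ 2 • A κ u + s₁ • B κ u) (fun ρ w => s₁ ^ 2 • P ρ w + s₁ • Q ρ w) T₁ M₂) μ y ν y' +
      w₂ • K3OfK K N (fun κ u => s₂ ^ 2 • A κ u + s₂ • B κ u) (fun ρ w => s₂ ^ 2 • P ρ w + s₂ • Q ρ w)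
          (W2SymOfK K N (fun κ u => s₂ ^ 2 • A κ u + s₂ • B κ u) (fun ρ w => s₂ ^ 2 • P ρ w + s₂ • Q ρ w) T₂ M₂) μ y ν y' +
      w₃ • K3OfK K N (fun κ u => s₃ ^ 2 • A κ u + s₃ • B κ u) (fun ρ w => s₃ ^ 2 • P ρ w + s₃ • Q ρ w)
          (W2SymOfK K N (fun κ u => s₃ ^ 2 • A κ u + s₃ • B κ u) (fun ρ w => s₃ ^ 2 • P ρ w + s₃ • Q ρ w) T₃ M₂) μ y ν y' +
      w₄ • K3OfK K N (fun κ u => s₄ ^ 2 • A κ u + s₄ • B κ u) (fun ρ w => s₄ ^ 2 • P ρ w + s₄ • Q ρ w)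
          (W2SymOfK K N (fun κ u => s₄ ^ 2 • A κ u + s₄ • B κ u) (fun ρ w => s₄ ^ 2 • P ρ w + s₄ • Q ρ w) T₄ M₂) μ y ν y' := by
  obtain ⟨δK, CK, hδK, -, hKd⟩ := id hK
  have hKs : Spr K := spr_of_decays hK
  obtain ⟨Bd, b₀, b₁, b₂, b₃, b₄⟩ := common_bound₂ hT₀ hT₁ hT₂ hT₃ hT₄
  rw [K3OfK_source_decomp hK hA hB hP hQ hM₂ Tt hTt t μ y ν y', K3OfK_source_decomp hK hA hB hP hQ hM₂ T₀ hT₀ s₀ μ y ν y', K3OfK_source_decomp hK hA hB hP hQ hM₂ T₁ hT₁ s₁ μ y ν y',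
    K3OfK_source_decomp hK hA hB hP hQ hM₂ T₂ hT₂ s₂ μ y ν y', K3OfK_source_decomp hK hA hB hP hQ hM₂ T₃ hT₃ s₃ μ y ν y', K3OfK_source_decomp hK hA hB hP hQ hM₂ T₄ hT₄ s₄ μ y ν y', hsum,
    vsym_wsum5 hKd hδK N b₀ b₁ b₂ b₃ b₄ w₀ w₁ w₂ w₃ w₄ μ y ν y',
    sandwich_wsum5 hKs (loc_vsym hK T₀ hT₀ μ y ν y') (loc_vsym hK T₁ hT₁ μ y ν y') (loc_vsym hK T₂ hT₂ μ y ν y') (loc_vsym hK T₃ hT₃ μ y ν y') (loc_vsym hK T₄ hT₄ μ y ν y')]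
  set X₄ := comp (comp K (dM K N A P μ y)) (K2OfK K N A P ν y') + comp (comp K (dM K N A P ν y')) (K2OfK K N A P μ y) with hX₄
  set X₃ := comp (comp K (dM K N A P μ y)) (K2OfK K N B Q ν y') + comp (comp K (dM K N B Q μ y)) (K2OfK K N A P ν y') +
    (comp (comp K (dM K N A P ν y')) (K2OfK K N B Q μ y) + comp (comp K (dM K N B Q ν y')) (K2OfK K N A P μ y)) with hX₃
  set X₂ := comp (comp K (dM K N B Q μ y)) (K2OfK K N B Q ν y') + comp (comp K (dM K N B Q ν y')) (K2OfK K N B Q μ y) with hX₂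
  set E₄ := comp (comp K (dM (K2OfK K N A P ν y') N A P μ y + dM (K2OfK K N A P μ y) N A P ν y')) K with hE₄
  set E₃ := comp (comp K (dM (K2OfK K N A P ν y') N B Q μ y + dM (K2OfK K N B Q ν y') N A P μ y + (dM (K2OfK K N A P μ y) N B Q ν y' + dM (K2OfK K N B Q μ y) N A P ν y'))) K with hE₃
  set E₂ := comp (comp K (dM (K2OfK K N B Q ν y') N B Q μ y + dM (K2OfK K N B Q μ y) N B Q ν y')) K with hE₂
  set W₀ := comp (comp K (W2SymOfK K N (fun (_ : Fin (d + 1)) (_ : Fin (d + 1) → ℤ) => (0 : MKer (d + 1) (Fib d))) (fun _ _ => 0) 0 M₂ μ y ν y')) K with hW₀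
  funext x z a b
  simp only [Pi.add_apply, Pi.sub_apply, Pi.neg_apply, Pi.smul_apply, smul_eq_mul]
  linear_combination (X₄ x z a b + E₄ x z a b / 2) * hm4 + (X₃ x z a b + E₃ x z a b / 2) * hm3 + (X₂ x z a b + E₂ x z a b / 2) * hm2 + W₀ x z a b * hm0

end OneLevel

/-! ## §3 The tower: an2's recursive bi-stencil family along a colour ray in the five-node form -/

section Tower

variable {Lc : ℕ} [NeZero Lc]

/-- [folklore] **an2's UNFOLDED FIRST FIELD STENCIL ALONG A COLOUR RAY IS A QUADRATIC PATH OF CERTIFIED TABLES**: `Spure (s·c⃗) j = s²•A_j + s•B_j` for all `s`, with `A_j, B_j` certified local field tables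
(member `0`: `A = 0`, `B = Spure c⃗ 0`; member `j+1`: `A = (cE·wE)•e3Of c⃗ (j+1)`, `B = Spure (0,cVH,cΛ) (j+1)` — GEN 10's `Spure_colourScale_zero ∕ _succ`, an2's `locStencil_Spure ∕ locStencil_e3Of`). -/
theorem Spure_ray (hLc : 1 ≤ Lc) (cE cVH cΛ : ℝ) : ∀ j : ℕ, ∃ A B : Fin (d + 1) → (Fin (d + 1) → ℤ) → MKer (d + 1) (Fib d),
    (∃ C δ : ℝ, 0 < δ ∧ LocStencil A C δ) ∧ (∃ C δ : ℝ, 0 < δ ∧ LocStencil B C δ) ∧ ∀ s : ℝ, Spure d Lc (s * cE) (s * cVH) (s * cΛ) j = fun κ u => s ^ 2 • A κ u + s • B κ u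
  | 0 => ⟨fun _ _ => 0, Spure d Lc cE cVH cΛ 0, (certs_zero (d := d) (N := Lc)).1, locStencil_Spure hLc cE cVH cΛ 0, fun s => by
      rw [Spure_colourScale_zero]; funext κ u; simp⟩
  | j + 1 => by
    obtain ⟨C₁, δ₁, hδ₁, h1⟩ := BalabanStepJetsSucc.locStencil_e3Of (d := d) (Lc := Lc) hLc cE cVH cΛ (j + 1)
    exact ⟨fun κ u => (cE * BalabanStepJetsSucc.wE d Lc (j + 1)) • e3Of d Lc cE cVH cΛ (j + 1) κ u, Spure d Lc 0 cVH cΛ (j + 1), ⟨_, δ₁, hδ₁, locStencil_smul _ h1⟩,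
      locStencil_Spure hLc 0 cVH cΛ (j + 1), fun s => by funext κ u; rw [Spure_colourScale_succ]⟩

omit [NeZero Lc] in
/-- [folklore] an2's first multiplier table along a colour ray is the (degenerate) quadratic path `s²•0 + s•M1 cΛ j` of certified tables (`M1_colourScale`, `vertexFamily_M1`). -/
theorem M1_ray (hLc : 1 ≤ Lc) (cΛ : ℝ) (j : ℕ) : ∃ P Q : Fin (d + 1) → (Fin (d + 1) → ℤ) → MKer (d + 1) (Fib d),
    (∃ C δ : ℝ, 0 < δ ∧ VertexFamily P Lc C δ) ∧ (∃ C δ : ℝ, 0 < δ ∧ VertexFamily Q Lc C δ) ∧ ∀ s : ℝ, M1 d Lc (s * cΛ) j = fun ρ w => s ^ 2 • P ρ w + s • Q ρ w :=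
  ⟨fun _ _ => 0, M1 d Lc cΛ j, (certs_zero (d := d) (N := Lc)).2, ⟨_, 1, one_pos, vertexFamily_M1 hLc cΛ j zero_le_one⟩, fun s => by
    rw [M1_colourScale]; funext ρ w; simp⟩

/-- [folklore] **THE TOWER: an2's RECURSIVE BI-STENCIL FAMILY ALONG A COLOUR RAY IN THE FIVE-NODE FORM** (`1 ≤ Lc`, any `cE₂, cB, T`, certified border and mixed tables, every level `j`):
for all nodes `s₀,…,s₄` and weights with `Σ wᵢ = 1`, `Σ wᵢ sᵢ^k = t^k` (`k = 2,3,4`),  `T2Of(t·c⃗) j = Σᵢ wᵢ • T2Of(sᵢ·c⃗) j` — member `0` carries no colour (`Σ wᵢ = 1`); member `j+1` by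
`K3OfK_ray_nodes` at an4's `KInvStep Lc j`, an2's certificates and the induction hypothesis in the bi-stencil slot, `mmRead` linear, the border constant. -/
theorem T2Of_ray_nodes (hLc : 1 ≤ Lc) (cE cVH cΛ cE₂ cB : ℝ) (T : Fin 4 → Fin 4 → Fin 4 → Fin 4 → ℝ)
    {vh₂S : Fin (d + 1) → (Fin (d + 1) → ℤ) → Fin (d + 1) → (Fin (d + 1) → ℤ) → MKer (d + 1) (Fib d)} (hB : ∃ C δ : ℝ, 0 < δ ∧ LocStencil₂ vh₂S C δ)
    {mixFF : Fin (d + 1) → (Fin (d + 1) → ℤ) → Fin (d + 1) → (Fin (d + 1) → ℤ) → MKer (d + 1) (Fib d)} (hmix : ∃ C δ : ℝ, 0 < δ ∧ LocStencilFM Lc mixFF C δ) :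
    ∀ (j : ℕ) (t s₀ s₁ s₂ s₃ s₄ w₀ w₁ w₂ w₃ w₄ : ℝ), w₀ + w₁ + w₂ + w₃ + w₄ = 1 → w₀ * s₀ ^ 2 + w₁ * s₁ ^ 2 + w₂ * s₂ ^ 2 + w₃ * s₃ ^ 2 + w₄ * s₄ ^ 2 = t ^ 2 →
      w₀ * s₀ ^ 3 + w₁ * s₁ ^ 3 + w₂ * s₂ ^ 3 + w₃ * s₃ ^ 3 + w₄ * s₄ ^ 3 = t ^ 3 → w₀ * s₀ ^ 4 + w₁ * s₁ ^ 4 + w₂ * s₂ ^ 4 + w₃ * s₃ ^ 4 + w₄ * s₄ ^ 4 = t ^ 4 →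
      T2Of d Lc (t * cE) (t * cVH) (t * cΛ) cE₂ cB T vh₂S mixFF j =
        w₀ • T2Of d Lc (s₀ * cE) (s₀ * cVH) (s₀ * cΛ) cE₂ cB T vh₂S mixFF j + w₁ • T2Of d Lc (s₁ * cE) (s₁ * cVH) (s₁ * cΛ) cE₂ cB T vh₂S mixFF j +
          w₂ • T2Of d Lc (s₂ * cE) (s₂ * cVH) (s₂ * cΛ) cE₂ cB T vh₂S mixFF j + w₃ • T2Of d Lc (s₃ * cE) (s₃ * cVH) (s₃ * cΛ) cE₂ cB T vh₂S mixFF j +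
          w₄ • T2Of d Lc (s₄ * cE) (s₄ * cVH) (s₄ * cΛ) cE₂ cB T vh₂S mixFF j
  | 0, t, s₀, s₁, s₂, s₃, s₄, w₀, w₁, w₂, w₃, w₄, hm0, _, _, _ => by
    simp only [T2Of_zero]
    rw [← add_smul, ← add_smul, ← add_smul, ← add_smul, hm0, one_smul]
  | j + 1, t, s₀, s₁, s₂, s₃, s₄, w₀, w₁, w₂, w₃, w₄, hm0, hm2, hm3, hm4 => by
    have IH := T2Of_ray_nodes hLc cE cVH cΛ cE₂ cB T hB hmix j t s₀ s₁ s₂ s₃ s₄ w₀ w₁ w₂ w₃ w₄ hm0 hm2 hm3 hm4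
    obtain ⟨A, Bf, hA, hBf, hS⟩ := Spure_ray (d := d) (Lc := Lc) hLc cE cVH cΛ j
    obtain ⟨P, Q, hP, hQ, hM⟩ := M1_ray (d := d) (Lc := Lc) hLc cΛ j
    have hK := decays_KInvStep (Lc := Lc) (d := d) j
    have hM₂ : ∃ C δ : ℝ, 0 < δ ∧ LocStencilFM Lc (M2Of d Lc mixFF j) C δ := by
      obtain ⟨C, δ, hδ, h⟩ := hmix; exact ⟨_, δ, hδ, locStencilFM_M2Of h j⟩
    have hTs : ∀ s : ℝ, ∃ C δ : ℝ, 0 < δ ∧ LocStencil₂ (T2Of d Lc (s * cE) (s * cVH) (s * cΛ) cE₂ cB T vh₂S mixFF j) C δ :=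
      fun s => T2Of_loc hLc _ _ _ cE₂ cB T hB hmix j
    have key := K3OfK_ray_nodes (N := Lc) hK hA hBf hP hQ hM₂ (hTs s₀) (hTs s₁) (hTs s₂) (hTs s₃) (hTs s₄) (hTs t) t s₀ s₁ s₂ s₃ s₄ w₀ w₁ w₂ w₃ w₄ hm0 hm2 hm3 hm4 IH
    funext κ u κ' u'
    simp only [T2Of_succ, Pi.add_apply, Pi.smul_apply]
    unfold BalabanStepW2.WbalOf BalabanStepW2.e4OfW
    rw [hS t, hS s₀, hS s₁, hS s₂, hS s₃, hS s₄, hM t, hM s₀, hM s₁, hM s₂, hM s₃, hM s₄, key κ u κ' u', mmRead_add, mmRead_add, mmRead_add, mmRead_add, mmRead_smul, mmRead_smul,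
      mmRead_smul, mmRead_smul, mmRead_smul]
    funext x z a b
    simp only [Pi.add_apply, Pi.smul_apply, smul_eq_mul]
    linear_combination (-(cB * wB2 d Lc (j + 1) * StepJetData.mfNeg (vh₂S κ u κ' u') x z a b)) * hm0

/-! ## §4 The assembled second-order family along a colour ray in the five-node form -/

/-- [folklore] **an2's ASSEMBLED SECOND-ORDER FAMILY ALONG A COLOUR RAY IN THE FIVE-NODE FORM** (same data, every level, every bond pair): with the same nodes and weights,
`WbalOf(t·c⃗)(T2Of(t·c⃗)) j b b′ = Σᵢ wᵢ • WbalOf(sᵢ·c⃗)(T2Of(sᵢ·c⃗)) j b b′` — `W2SymOfK_path` (the first-order part is `½•[t⁴E₄ + t³E₃ + t²E₂]`), `W2SymOfK_eq_add_vsym` + `vsym_wsum5` on §3's identity. -/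
theorem WbalOf_ray_nodes (hLc : 1 ≤ Lc) (cE cVH cΛ cE₂ cB : ℝ) (T : Fin 4 → Fin 4 → Fin 4 → Fin 4 → ℝ)
    {vh₂S : Fin (d + 1) → (Fin (d + 1) → ℤ) → Fin (d + 1) → (Fin (d + 1) → ℤ) → MKer (d + 1) (Fib d)} (hB : ∃ C δ : ℝ, 0 < δ ∧ LocStencil₂ vh₂S C δ)
    {mixFF : Fin (d + 1) → (Fin (d + 1) → ℤ) → Fin (d + 1) → (Fin (d + 1) → ℤ) → MKer (d + 1) (Fib d)} (hmix : ∃ C δ : ℝ, 0 < δ ∧ LocStencilFM Lc mixFF C δ)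
    (j : ℕ) (t s₀ s₁ s₂ s₃ s₄ w₀ w₁ w₂ w₃ w₄ : ℝ) (hm0 : w₀ + w₁ + w₂ + w₃ + w₄ = 1) (hm2 : w₀ * s₀ ^ 2 + w₁ * s₁ ^ 2 + w₂ * s₂ ^ 2 + w₃ * s₃ ^ 2 + w₄ * s₄ ^ 2 = t ^ 2)
    (hm3 : w₀ * s₀ ^ 3 + w₁ * s₁ ^ 3 + w₂ * s₂ ^ 3 + w₃ * s₃ ^ 3 + w₄ * s₄ ^ 3 = t ^ 3) (hm4 : w₀ * s₀ ^ 4 + w₁ * s₁ ^ 4 + w₂ * s₂ ^ 4 + w₃ * s₃ ^ 4 + w₄ * s₄ ^ 4 = t ^ 4)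
    (μ : Fin (d + 1)) (y : Fin (d + 1) → ℤ) (ν : Fin (d + 1)) (y' : Fin (d + 1) → ℤ) :
    WbalOf d Lc (t * cE) (t * cVH) (t * cΛ) (T2Of d Lc (t * cE) (t * cVH) (t * cΛ) cE₂ cB T vh₂S mixFF) mixFF j μ y ν y' =
      w₀ • WbalOf d Lc (s₀ * cE) (s₀ * cVH) (s₀ * cΛ) (T2Of d Lc (s₀ * cE) (s₀ * cVH) (s₀ * cΛ) cE₂ cB T vh₂S mixFF) mixFF j μ y ν y' +
      w₁ • WbalOf d Lc (s₁ * cE) (s₁ * cVH) (s₁ * cΛ) (T2Of d Lc (s₁ * cE) (s₁ * cVH) (s₁ * cΛ) cE₂ cB T vh₂S mixFF) mixFF j μ y ν y' +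
      w₂ • WbalOf d Lc (s₂ * cE) (s₂ * cVH) (s₂ * cΛ) (T2Of d Lc (s₂ * cE) (s₂ * cVH) (s₂ * cΛ) cE₂ cB T vh₂S mixFF) mixFF j μ y ν y' +
      w₃ • WbalOf d Lc (s₃ * cE) (s₃ * cVH) (s₃ * cΛ) (T2Of d Lc (s₃ * cE) (s₃ * cVH) (s₃ * cΛ) cE₂ cB T vh₂S mixFF) mixFF j μ y ν y' +
      w₄ • WbalOf d Lc (s₄ * cE) (s₄ * cVH) (s₄ * cΛ) (T2Of d Lc (s₄ * cE) (s₄ * cVH) (s₄ * cΛ) cE₂ cB T vh₂S mixFF) mixFF j μ y ν y' := by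
  have IH := T2Of_ray_nodes hLc cE cVH cΛ cE₂ cB T hB hmix j t s₀ s₁ s₂ s₃ s₄ w₀ w₁ w₂ w₃ w₄ hm0 hm2 hm3 hm4
  obtain ⟨A, Bf, hA, hBf, hS⟩ := Spure_ray (d := d) (Lc := Lc) hLc cE cVH cΛ j
  obtain ⟨P, Q, hP, hQ, hM⟩ := M1_ray (d := d) (Lc := Lc) hLc cΛ j
  have hK := decays_KInvStep (Lc := Lc) (d := d) j
  obtain ⟨δK, CK, hδK, -, hKd⟩ := id hK
  obtain ⟨Bd, b₀, b₁, b₂, b₃, b₄⟩ := common_bound₂ (T2Of_loc hLc (s₀ * cE) (s₀ * cVH) (s₀ * cΛ) cE₂ cB T hB hmix j) (T2Of_loc hLc (s₁ * cE) (s₁ * cVH) (s₁ * cΛ) cE₂ cB T hB hmix j)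
    (T2Of_loc hLc (s₂ * cE) (s₂ * cVH) (s₂ * cΛ) cE₂ cB T hB hmix j) (T2Of_loc hLc (s₃ * cE) (s₃ * cVH) (s₃ * cΛ) cE₂ cB T hB hmix j) (T2Of_loc hLc (s₄ * cE) (s₄ * cVH) (s₄ * cΛ) cE₂ cB T hB hmix j)
  have ev : ∀ S₂ : Fin (d + 1) → (Fin (d + 1) → ℤ) → Fin (d + 1) → (Fin (d + 1) → ℤ) → MKer (d + 1) (Fib d),
      W2SymOfK (KInvStep (d := d) Lc j) Lc (fun (_ : Fin (d + 1)) (_ : Fin (d + 1) → ℤ) => (0 : MKer (d + 1) (Fib d))) (fun _ _ => 0) S₂ (M2Of d Lc mixFF j) μ y ν y' =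
        W2SymOfK (KInvStep (d := d) Lc j) Lc (fun (_ : Fin (d + 1)) (_ : Fin (d + 1) → ℤ) => (0 : MKer (d + 1) (Fib d))) (fun _ _ => 0) 0 (M2Of d Lc mixFF j) μ y ν y' +
          vsym (KInvStep (d := d) Lc j) Lc S₂ μ y ν y' := fun S₂ => by
    have e := congrArg (fun F => F μ y ν y') (W2SymOfK_eq_add_vsym (KInvStep (d := d) Lc j) Lc (fun (_ : Fin (d + 1)) (_ : Fin (d + 1) → ℤ) => (0 : MKer (d + 1) (Fib d))) (fun _ _ => 0) S₂ (M2Of d Lc mixFF j))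
    simpa only [Pi.add_apply] using e
  unfold BalabanStepW2.WbalOf
  rw [hS t, hS s₀, hS s₁, hS s₂, hS s₃, hS s₄, hM t, hM s₀, hM s₁, hM s₂, hM s₃, hM s₄, W2SymOfK_path hK hA hBf hP hQ _ _ t μ y ν y', W2SymOfK_path hK hA hBf hP hQ _ _ s₀ μ y ν y',
    W2SymOfK_path hK hA hBf hP hQ _ _ s₁ μ y ν y', W2SymOfK_path hK hA hBf hP hQ _ _ s₂ μ y ν y', W2SymOfK_path hK hA hBf hP hQ _ _ s₃ μ y ν y', W2SymOfK_path hK hA hBf hP hQ _ _ s₄ μ y ν y',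
    ev, ev (T2Of d Lc (s₀ * cE) (s₀ * cVH) (s₀ * cΛ) cE₂ cB T vh₂S mixFF j), ev (T2Of d Lc (s₁ * cE) (s₁ * cVH) (s₁ * cΛ) cE₂ cB T vh₂S mixFF j),
    ev (T2Of d Lc (s₂ * cE) (s₂ * cVH) (s₂ * cΛ) cE₂ cB T vh₂S mixFF j), ev (T2Of d Lc (s₃ * cE) (s₃ * cVH) (s₃ * cΛ) cE₂ cB T vh₂S mixFF j),
    ev (T2Of d Lc (s₄ * cE) (s₄ * cVH) (s₄ * cΛ) cE₂ cB T vh₂S mixFF j), IH, vsym_wsum5 hKd hδK Lc b₀ b₁ b₂ b₃ b₄ w₀ w₁ w₂ w₃ w₄ μ y ν y']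
  set E₄ := dM (K2OfK (KInvStep (d := d) Lc j) Lc A P ν y') Lc A P μ y + dM (K2OfK (KInvStep (d := d) Lc j) Lc A P μ y) Lc A P ν y' with hE₄
  set E₃ := dM (K2OfK (KInvStep (d := d) Lc j) Lc A P ν y') Lc Bf Q μ y + dM (K2OfK (KInvStep (d := d) Lc j) Lc Bf Q ν y') Lc A P μ y +
    (dM (K2OfK (KInvStep (d := d) Lc j) Lc A P μ y) Lc Bf Q ν y' + dM (K2OfK (KInvStep (d := d) Lc j) Lc Bf Q μ y) Lc A P ν y') with hE₃
  set E₂ := dM (K2OfK (KInvStep (d := d) Lc j) Lc Bf Q ν y') Lc Bf Q μ y + dM (K2OfK (KInvStep (d := d) Lc j) Lc Bf Q μ y) Lc Bf Q ν y' with hE₂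
  set W₀ := W2SymOfK (KInvStep (d := d) Lc j) Lc (fun (_ : Fin (d + 1)) (_ : Fin (d + 1) → ℤ) => (0 : MKer (d + 1) (Fib d))) (fun _ _ => 0) 0 (M2Of d Lc mixFF j) μ y ν y' with hW₀
  funext x z a b
  simp only [Pi.add_apply, Pi.smul_apply, smul_eq_mul]
  linear_combination (-(E₄ x z a b) / 2) * hm4 + (-(E₃ x z a b) / 2) * hm3 + (-(E₂ x z a b) / 2) * hm2 - W₀ x z a b * hm0

end Tower

end Summit.QuantumFields.BalabanUV.Gaps.D1PinnedColourRayQuartic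

end
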